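import Summits.BirchSwinnertonDyer.BirchSwinnertonDyer.Theorems.KimAtThreeShallowEqDeepTwistedOfKatoV2
import Summits.BirchSwinnertonDyer.BirchSwinnertonDyer.Theorems.KimAtThreeShallowEqDeepWeightedItems
import Summits.BirchSwinnertonDyer.BirchSwinnertonDyer.Theorems.KimAtThreeShallowEqDeepWeightedOfKatoV2
import Summits.BirchSwinnertonDyer.BirchSwinnertonDyer.Theorems.KimAtThreeShallowEqDeepGoodOfDefinedKato
import HarnessLib

/-!
# Route `KimAtThreeKolyvagin` (W2): support item 20397 `FineKatoTauAnomalousThree` BY NAME, and the whole NON-ADDITIVE half of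
# cruxes 19599 / 19077 BY NAME, FROM the leaves, the cite facts (S5a) · (S5b-tower) and the ONE Kato-side statement hKatoV2ʷ
# (cell `bsd-addord`, seat w2-c4 gen 12; `--supports` 19077, helper)

HONEST FRAMING.  END-TYPE THEOREMS WITH DISPLAYED HYPOTHESES (no definition, no named fact, no instance, no `sorry`): the
leaves ([S24] Thm 4.4 (1)(2), GZK, Poitou–Tate; Carayol and crux 19560 for 19077) are ROUTE DECLS or cite-only named facts
carried as hypotheses; (S5a) `PAdicHodge.expStarCoord_eq_zero_iff_kummer` and (S5b-tower)
`PAdicHodge.exists_smul_range_expStarCoord_tower_iff_trace_log` are cite-only named facts; hKatoV2ʷ (section variable `hKatoV2`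
below = w2-c2 g9's hKatoV2ᵘ text VERBATIM with kim3's R-κ clause, i.e. gen 11's binder of p531776) is DISPLAYED — Kato 2004
(8.1.3)/8.12/9.7∘6.6(1) over the DEFINED dual exponentials at every `3`-adic-tower row with a lattice-optimal parametrisation
at the conductor, plus Kato's unit constant; item 20398 `FineKatoTwoExpDefectThree` (the additive-defect rows, seat acc3's
(C1₂)) stays a ROUTE-DECL hypothesis.  Nothing is closed or booked; 19560 / 19599 / 19077 / 20275 / 20397 / 20398 stay OPEN;
BSD is not proved by any of this.

WHAT.
* §1 **`fineKatoTauAnomalousThree_of_katoV2_of_facts`** — item 20397 BY NAME ⟸ (S5a) ∧ (S5b-tower) ∧ hKatoV2ʷ: this seat's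
  `definedKatoTwist_of_katoV2_of_facts` ((C1ₑₓ^τ) on every good-anomalous `t = 0` row) through gen 10's
  `fineKatoτ_of_definedKatoTwist` (no digit lost: the twist operator is injective).
* §2 `stub19599_nonAdditive_of_katoV2_of_facts` — crux 19599's `stub_nonAdditive` (BC3 text VERBATIM) ⟸ [S24](1)(2) ∧ GZK ∧ PT
  ∧ (S5a) ∧ (S5b-tower) ∧ hKatoV2ʷ (dispatch of `KimAtThreeShallowEqDeepWeightedItems` fed with item 20275 BY NAME — gen 11's
  `definedKatoWeighted_of_katoV2_of_facts` row by row, as in `KimAtThreeShallowEqDeepWeightedItemOfKatoV2` — and item 20397 BY NAME from §1).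
* §3 **`shallowEqDeepOffKatoStratum_of_katoV2_of_facts`** — crux 19599 BY NAME ⟸ `SakamotoKolyvaginThree ∧ RankEqAnalyticRankLeOne
  ∧ PoitouTateSelmerDuality` ∧ (S5a) ∧ (S5b-tower) ∧ hKatoV2ʷ ∧ item 20398;
  **`shallowEqDeepAtTorsionFree_of_katoV2_of_facts`** — crux 19077 BY NAME ⟸ the same ∧ `CarayolLevelEqConductor ∧
  KatoKuriharaPortThreeShared` (crux 19560).
READING (08-28, W2 shallow cruxes): EVERY non-additive `t = 0` row of 19599 / 19077 — good ordinary, good supersingular,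
good ANOMALOUS, multiplicative — now rests on EXACTLY the deep family's displayed Kato-side statement hKatoV2ʷ (19075 / 19076 /
20013 ⟸ leaves ∧ (S5a) ∧ (S5b-tower) ∧ hKatoV2ᵘ, w2-c3 g8) plus Kato's R-κ; the additive rows keep acc3's (C1₂) (item 20398) /
kim3's (C1ₑₓ⁰ᵘ); 19077 additionally needs crux 19560.
References: [Kato2004Asterisque] (8.1.3), §9.4, Thm. 9.7, Ex. 13.3; [BlochKato1990] §3 Prop. 3.8, Ex. 3.11;
[Kim2022StructureSelmer] Thm. 1.9 (6), §3.2.3, Lemma 3.4, Cor. 3.5, Thm. 3.13; [Kim2025RefinedTNC] Thm. 1.1/1.2; [Sakamoto2024]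
Thm. 4.4; [MazurRubin2004] Thm. 4.4.1, 5.2.12; [Carayol1986]; memos HOME/w2c4/W2C4-ANOMALOUS-PORT-g9.md, W2C4-WEIGHTED-COMPAT-g11.md.
-/

set_option autoImplicit false

noncomputable section

-- the cell's Theorems namespace `Summit.BirchSwinnertonDyer.BirchSwinnertonDyer.…` repeats the summit name by design (D-0017)
set_option linter.dupNamespace false

open scoped Classical NumberField TensorProduct ContRepresentation Pointwise
open Field ValuativeRel Function IsDedekindDomain NumberField
open WeierstrassCurve Literature.NumberTheory.EllipticCurves Literature.NumberTheory.GaloisRepresentations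
  Literature.NumberTheory.GaloisRepresentations.DiscreteGaloisModule Literature.NumberTheory.GaloisCohomology
open Literature.NumberTheory.GaloisRepresentations.PeriodRingData Literature.NumberTheory.PAdicHodge Literature.NumberTheory.EllipticCurves.ModularForms Literature.NumberTheory.EllipticCurves.Rank1Residual
open Literature.NumberTheory.EllipticCurves.Kato2004 Literature.NumberTheory.EllipticCurves.Kato2004.EulerSystemValues
open Literature.NumberTheory.AdelicBaseChange Literature.NumberTheory.Automorphic
open Summit.BirchSwinnertonDyer.Rank1Residual.GaloisImage Summit.BirchSwinnertonDyer.Rank1Residual.Additive.LocalLog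
open Summit.BirchSwinnertonDyer.BirchSwinnertonDyer.Theorems
open Summit.BirchSwinnertonDyer.BirchSwinnertonDyer.Theorems.KimAtThreeFineKatoLevelCompat
open Summit.BirchSwinnertonDyer.BirchSwinnertonDyer.Theorems.KimAtThreeFineKatoPerFactorDefined
open Summit.BirchSwinnertonDyer.BirchSwinnertonDyer.Theorems.KimAtThreeFineKatoPerFactorDefinedTwist
open Summit.BirchSwinnertonDyer.BirchSwinnertonDyer.Theorems.KimAtThreeDeepLowerExpStarOmega
open Summit.BirchSwinnertonDyer.BirchSwinnertonDyer.Theorems.KimAtThreeDeepLowerExpStarOmegaPlace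
open Summit.BirchSwinnertonDyer.BirchSwinnertonDyer.Theorems.KimAtThreeFineKatoPerFactorPlaces
open Summit.BirchSwinnertonDyer.BirchSwinnertonDyer.Theorems.KimAtThreeDeepUpperExpStarFacts
open Summit.BirchSwinnertonDyer.Rank1Residual.GaloisImage.TameLevel (squarefree_cycLevel_zero)
open Summit.BirchSwinnertonDyer.BirchSwinnertonDyer.Theorems.KimAtThreeSemiLocalTraceDualCyc
open Summit.BirchSwinnertonDyer.BirchSwinnertonDyer.Theorems.KimAtThreeShallowEqDeepTraceDualLattice
open Summit.BirchSwinnertonDyer.BirchSwinnertonDyer.Theorems.KimAtThreeShallowEqDeepWildDifferentLocal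
open Summit.BirchSwinnertonDyer.BirchSwinnertonDyer.Theorems.KimAtThreeShallowEqDeepRiderOfWeightedCompat
open Summit.BirchSwinnertonDyer.BirchSwinnertonDyer.Theses.KimAtThreeKolyvagin
open Summit.BirchSwinnertonDyer.BirchSwinnertonDyer.Theorems.KimAtThreeShallowEqDeepNonAdditiveOfFineKato
  (hasGoodReductionAtPrime_three_of_not_dvd_conductorNorm)
open Summit.BirchSwinnertonDyer.BirchSwinnertonDyer.Theorems.KimAtThreeShallowEqDeepSplitGlueNoStub
  (shallowEqDeepAtTorsionFree_of_parts_noStub)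
open Summit.BirchSwinnertonDyer.BirchSwinnertonDyer.Theorems.KimAtThreeShallowEqDeepTwistedOfKatoV2
open Summit.BirchSwinnertonDyer.BirchSwinnertonDyer.Theorems.KimAtThreeShallowEqDeepWeightedItems
open Summit.BirchSwinnertonDyer.BirchSwinnertonDyer.Theorems.KimAtThreeShallowEqDeepWeightedOfKatoV2
  (definedKatoWeighted_of_katoV2_of_facts)
open Summit.BirchSwinnertonDyer.BirchSwinnertonDyer.Theorems.KimAtThreeShallowEqDeepGoodOfDefinedKato
  (fineKatoτ_of_definedKatoTwist)

namespace Summit.BirchSwinnertonDyer.BirchSwinnertonDyer.Theorems.KimAtThreeShallowEqDeepNonAdditiveOfKatoV2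

/-- Local notation: the `stub_nonAdditive` signature of crux 19599 (BC3 birth skeleton
`Cruxes/ShallowEqDeepOffKatoStratum/Lines/birth.lean`), VERBATIM. -/
local notation3 (prettyPrint := false) "STUB19599NA" =>
  ∀ (W₀ : WeierstrassCurve ℚ) [W₀.IsElliptic] [W₀.IsGloballyMinimal],
    (∀ n : ℕ, W₀.HasSurjectiveModNGaloisRep (3 ^ n : ℕ)) →
    Nat.card {Q : (W₀.baseChange ℚ_[3]).toAffine.Point // (3 : ℕ) • Q = 0} = 1 → Finite W₀.sha →
    ∀ {N : ℕ} [NeZero N], N = W₀.conductorNorm ℤ →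
    ∀ (D₀ : Literature.NumberTheory.EllipticCurves.ModularForms.ModularParametrizationData W₀ N),
      (∀ z ∈ D₀.L.lattice, ∃ w ∈ Literature.NumberTheory.EllipticCurves.ModularForms.periodLattice D₀.f, z = D₀.c * w) →
      (∀ (W₂ : WeierstrassCurve ℚ) [W₂.IsElliptic]
        (D₂ : Literature.NumberTheory.EllipticCurves.ModularForms.ModularParametrizationData W₂ N),
        D₂.f = D₀.f → D₀.modularDegree ≤ D₂.modularDegree) →
      (∀ r : ℚ, Literature.NumberTheory.EllipticCurves.ratPlusSymbol D₀.f r ≠ 0 →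
        0 ≤ padicValRat 3 (Literature.NumberTheory.EllipticCurves.ratPlusSymbol D₀.f r)) →
      Literature.NumberTheory.EllipticCurves.kuriharaVanishingOrder W₀ 3 D₀.f = 0 →
      ¬ (haveI : Fact (Nat.Prime 3) := ⟨Nat.prime_three⟩;
          Literature.NumberTheory.EllipticCurves.Rank1Residual.Addv W₀ 3) →
      Literature.NumberTheory.EllipticCurves.kuriharaPartialDeepInfty W₀ 3 D₀.f ≤
        Literature.NumberTheory.EllipticCurves.kuriharaPartialInfty W₀ 3 D₀.f

/-! ### The displayed hypotheses (section variables): (S5a), (S5b-tower), hKatoV2ʷ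

`hKatoV2` — **hKatoV2ʷ** — is w2-c2 g9's hKatoV2ᵘ text VERBATIM with kim3's R-κ clause `∃ u : ℚ, u = κK ∧ v₃(u) = 0` (= gen 11's
`hKatoV2` binder of `KimAtThreeShallowEqDeepWeightedOfKatoV2.definedKatoWeighted_of_katoV2_of_facts`, p531776; = the binder of this
seat's `definedKatoTwist_of_katoV2_of_facts`): at every `3`-adic-tower row with a lattice-optimal parametrisation at the conductor, a
Néron line `d` at `v₃` with Prop-1.2.3 binders and `hdual`, and `(ι, κK, Λ)` with `κK ≠ 0` a rational `3`-unit, (DEF_w)/(RES_w)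
pinning `Λ_{0,r}` to the DEFINED `exp*_{d_w}` at every level `r` and place `w ∣ 3` under every semi-local chart `Ψ`, and Kato's
`ZetaBody` family. -/

section OfKatoV2

variable (hKatoV2 :
    ∀ (W : WeierstrassCurve ℚ) [W.IsElliptic] [W.IsGloballyMinimal]
        [ContinuousSMul ℤ_[3] (W.tateModule 3)] [Module.Free ℤ_[3] (W.tateModule 3)]
        [Module.Finite ℤ_[3] (W.tateModule 3)],
        (∀ m : ℕ, W.HasSurjectiveModNGaloisRep (3 ^ m : ℕ)) →
        ∀ {N : ℕ} [NeZero N] (P : ModularParametrizationData W N), N = W.conductorNorm ℤ →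
          (∀ z ∈ P.L.lattice, ∃ w ∈ periodLattice P.f, z = P.c * w) →
          haveI : Fact (((3 : ℕ) : 𝓞 ℚ) ∈ ((Rat.HeightOneSpectrum.primesEquiv (R := 𝓞 ℚ)).symm ⟨3, Fact.out⟩).asIdeal) :=
            ⟨(natCast_mem_asIdeal_iff_eq_primesEquiv_symm _ Nat.prime_three).mpr rfl⟩
          letI := valuativeRelPlace ((Rat.HeightOneSpectrum.primesEquiv (R := 𝓞 ℚ)).symm ⟨3, Fact.out⟩)
          letI := topologicalSpacePlace ((Rat.HeightOneSpectrum.primesEquiv (R := 𝓞 ℚ)).symm ⟨3, Fact.out⟩)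
          haveI := isNonarchimedeanLocalField_place ((Rat.HeightOneSpectrum.primesEquiv (R := 𝓞 ℚ)).symm ⟨3, Fact.out⟩)
          haveI := charZero_place ((Rat.HeightOneSpectrum.primesEquiv (R := 𝓞 ℚ)).symm ⟨3, Fact.out⟩)
          letI := padicAlgebraPlace 3 ((Rat.HeightOneSpectrum.primesEquiv (R := 𝓞 ℚ)).symm ⟨3, Fact.out⟩)
          haveI := fact_not_isUnit_place 3 ((Rat.HeightOneSpectrum.primesEquiv (R := 𝓞 ℚ)).symm ⟨3, Fact.out⟩)
          haveI := isAdicComplete_place 3 ((Rat.HeightOneSpectrum.primesEquiv (R := 𝓞 ℚ)).symm ⟨3, Fact.out⟩)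
          ∃ (d : LocalNeronLineAt W 3 ((Rat.HeightOneSpectrum.primesEquiv (R := 𝓞 ℚ)).symm ⟨3, Fact.out⟩))
            (hinj : (bdRPeriodRingData (valuation_place_lt_one 3 ((Rat.HeightOneSpectrum.primesEquiv (R := 𝓞 ℚ)).symm ⟨3, Fact.out⟩))).CupLogInjective (logCyclotomic 3)
              (localRationalTateRep W 3 (galRestrictPlace ((Rat.HeightOneSpectrum.primesEquiv (R := 𝓞 ℚ)).symm ⟨3, Fact.out⟩))))
            (hex : ∀ z : contOneCocycles (localRationalTateRep W 3 (galRestrictPlace ((Rat.HeightOneSpectrum.primesEquiv (R := 𝓞 ℚ)).symm ⟨3, Fact.out⟩))).toTopRep,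
              (bdRPeriodRingData (valuation_place_lt_one 3 ((Rat.HeightOneSpectrum.primesEquiv (R := 𝓞 ℚ)).symm ⟨3, Fact.out⟩))).HasDualExp (logCyclotomic 3)
                (localRationalTateRep W 3 (galRestrictPlace ((Rat.HeightOneSpectrum.primesEquiv (R := 𝓞 ℚ)).symm ⟨3, Fact.out⟩))) fun σ => z.1 σ),
            (∀ a : ℚ_[3], (∃ y, (expStarOmegaPadicAt d hinj hex (((Padic.adicCompletionEquiv (𝓞 ℚ) ⟨3, Fact.out⟩).symm : (((Rat.HeightOneSpectrum.primesEquiv (R := 𝓞 ℚ)).symm ⟨3, Fact.out⟩).adicCompletion ℚ) →+* ℚ_[3]))) y = a) ↔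
              ∀ Q : (W.baseChange ℚ_[3]).toAffine.Point, ‖a * padicLog (W.baseChange ℚ_[3]) Q‖ ≤ 1) ∧
          ∃ (ι : (n : ℕ) → (CyclotomicField n ℚ →+* ℂ)) (κK : ℝ)
            (Λ : ∀ (k' : ℕ) (r : Finset (HeightOneSpectrum (𝓞 ℚ))),
              H1 (tateRep W 3) (cycSubgroup 3 k' r) →ₗ[ℤ_[3]]
                ℚ_[3] ⊗[ℚ] CyclotomicField (cycLevel 3 k' r) ℚ),
            κK ≠ 0 ∧ (∃ u : ℚ, (u : ℝ) = κK ∧ padicValRat 3 u = 0) ∧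
            (∀ (j : ℕ) (r : Finset (HeightOneSpectrum (𝓞 ℚ)))
              (Ψ : ℚ_[3] ⊗[ℚ] CyclotomicField (cycLevel 3 0 r) ℚ ≃ₐ[ℚ]
                (Π w : ((Rat.HeightOneSpectrum.primesEquiv (R := 𝓞 ℚ)).symm ⟨3, Fact.out⟩).Extension
                  (𝓞 (CyclotomicField (cycLevel 3 0 r) ℚ)), w.1.adicCompletion (CyclotomicField (cycLevel 3 0 r) ℚ)))
              (hΨ : ∀ (s : ℚ_[3]) (x : CyclotomicField (cycLevel 3 0 r) ℚ)
                (w : ((Rat.HeightOneSpectrum.primesEquiv (R := 𝓞 ℚ)).symm ⟨3, Fact.out⟩).Extension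
                  (𝓞 (CyclotomicField (cycLevel 3 0 r) ℚ))),
                Ψ (s ⊗ₜ[ℚ] x) w =
                  algebraMap (CyclotomicField (cycLevel 3 0 r) ℚ) (w.1.adicCompletion (CyclotomicField (cycLevel 3 0 r) ℚ)) x *
                  algebraMap (((Rat.HeightOneSpectrum.primesEquiv (R := 𝓞 ℚ)).symm ⟨3, Fact.out⟩).adicCompletion ℚ)
                    (w.1.adicCompletion (CyclotomicField (cycLevel 3 0 r) ℚ)) ((Padic.adicCompletionEquiv (𝓞 ℚ) ⟨3, Fact.out⟩) s)),
              ∃ (w₀ : ((Rat.HeightOneSpectrum.primesEquiv (R := 𝓞 ℚ)).symm ⟨3, Fact.out⟩).Extension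
                  (𝓞 (CyclotomicField (cycLevel 3 0 r) ℚ)))
                (g : ((Rat.HeightOneSpectrum.primesEquiv (R := 𝓞 ℚ)).symm ⟨3, Fact.out⟩).Extension
                  (𝓞 (CyclotomicField (cycLevel 3 0 r) ℚ)) → absoluteGaloisGroup ℚ)
                (hg : ∀ w : ((Rat.HeightOneSpectrum.primesEquiv (R := 𝓞 ℚ)).symm ⟨3, Fact.out⟩).Extension
                  (𝓞 (CyclotomicField (cycLevel 3 0 r) ℚ)),
                  sigma (cycLevel 3 0 r) (modNCyclotomicCharacter ℚ (cycLevel 3 0 r) (g w)) • w.1 = w₀.1),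
                  letI := LocalField.charZero_adicCompletion w₀.1
                  letI := LocalField.adicCompletionPadicAlgebra w₀.1 3 (three_mem_asIdeal_extension _ w₀)
                  haveI : Fact (¬ IsUnit ((3 : ℕ) : integerC (w₀.1.adicCompletion (CyclotomicField (cycLevel 3 0 r) ℚ)))) :=
                    ⟨not_isUnit_natCast_integerC (LocalField.valuation_adicCompletion_natCast_lt_one w₀.1 3 (three_mem_asIdeal_extension _ w₀))⟩
                  haveI := isAdicComplete_integerC_natCast (LocalField.valuation_adicCompletion_natCast_lt_one w₀.1 3 (three_mem_asIdeal_extension _ w₀))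
                  ∃ (dw : LocalNeronLine W (LocalField.valuation_adicCompletion_natCast_lt_one w₀.1 3 (three_mem_asIdeal_extension _ w₀))
                    ((galRestrictPlace ((Rat.HeightOneSpectrum.primesEquiv (R := 𝓞 ℚ)).symm ⟨3, Fact.out⟩)).comp
                      (absGaloisRestrict (((Rat.HeightOneSpectrum.primesEquiv (R := 𝓞 ℚ)).symm ⟨3, Fact.out⟩).adicCompletion ℚ) (w₀.1.adicCompletion (CyclotomicField (cycLevel 3 0 r) ℚ)))))
                    (hinjw : (bdRPeriodRingData (LocalField.valuation_adicCompletion_natCast_lt_one w₀.1 3 (three_mem_asIdeal_extension _ w₀))).CupLogInjective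
                    (logCyclotomic 3) (localRationalTateRep W 3 ((galRestrictPlace ((Rat.HeightOneSpectrum.primesEquiv (R := 𝓞 ℚ)).symm ⟨3, Fact.out⟩)).comp
                      (absGaloisRestrict (((Rat.HeightOneSpectrum.primesEquiv (R := 𝓞 ℚ)).symm ⟨3, Fact.out⟩).adicCompletion ℚ) (w₀.1.adicCompletion (CyclotomicField (cycLevel 3 0 r) ℚ))))))
                    (hexw : ∀ z : contOneCocycles (localRationalTateRep W 3 ((galRestrictPlace ((Rat.HeightOneSpectrum.primesEquiv (R := 𝓞 ℚ)).symm ⟨3, Fact.out⟩)).comp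
                      (absGaloisRestrict (((Rat.HeightOneSpectrum.primesEquiv (R := 𝓞 ℚ)).symm ⟨3, Fact.out⟩).adicCompletion ℚ) (w₀.1.adicCompletion (CyclotomicField (cycLevel 3 0 r) ℚ))))).toTopRep,
                    (bdRPeriodRingData (LocalField.valuation_adicCompletion_natCast_lt_one w₀.1 3 (three_mem_asIdeal_extension _ w₀))).HasDualExp
                      (logCyclotomic 3) (localRationalTateRep W 3 ((galRestrictPlace ((Rat.HeightOneSpectrum.primesEquiv (R := 𝓞 ℚ)).symm ⟨3, Fact.out⟩)).comp
                      (absGaloisRestrict (((Rat.HeightOneSpectrum.primesEquiv (R := 𝓞 ℚ)).symm ⟨3, Fact.out⟩).adicCompletion ℚ) (w₀.1.adicCompletion (CyclotomicField (cycLevel 3 0 r) ℚ))))) fun σ => z.1 σ),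
                    (∀ (h : (tateLocalRep W 3 (Sum.inr ((Rat.HeightOneSpectrum.primesEquiv (R := 𝓞 ℚ)).symm ⟨3, Fact.out⟩))).cohomology 1),
                    (expStarOmegaHom (LocalField.valuation_adicCompletion_natCast_lt_one w₀.1 3 (three_mem_asIdeal_extension _ w₀))
                      ((galRestrictPlace ((Rat.HeightOneSpectrum.primesEquiv (R := 𝓞 ℚ)).symm ⟨3, Fact.out⟩)).comp
                      (absGaloisRestrict (((Rat.HeightOneSpectrum.primesEquiv (R := 𝓞 ℚ)).symm ⟨3, Fact.out⟩).adicCompletion ℚ) (w₀.1.adicCompletion (CyclotomicField (cycLevel 3 0 r) ℚ)))) dw hinjw hexw)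
                      (ContinuousRep.cohomologyRes (tateLocalRep W 3 (Sum.inr ((Rat.HeightOneSpectrum.primesEquiv (R := 𝓞 ℚ)).symm ⟨3, Fact.out⟩)))
                        (absGaloisRestrict (((Rat.HeightOneSpectrum.primesEquiv (R := 𝓞 ℚ)).symm ⟨3, Fact.out⟩).adicCompletion ℚ) (w₀.1.adicCompletion (CyclotomicField (cycLevel 3 0 r) ℚ))) 1 h) =
                    algebraMap (((Rat.HeightOneSpectrum.primesEquiv (R := 𝓞 ℚ)).symm ⟨3, Fact.out⟩).adicCompletion ℚ) (w₀.1.adicCompletion (CyclotomicField (cycLevel 3 0 r) ℚ)) (expStarOmegaAt d h)) ∧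
                    (∀ (w : ((Rat.HeightOneSpectrum.primesEquiv (R := 𝓞 ℚ)).symm ⟨3, Fact.out⟩).Extension
                      (𝓞 (CyclotomicField (cycLevel 3 0 r) ℚ)))
                    (y : H1 (tateRep W 3) (cycSubgroup 3 0 r))
                    (φ'' : contOneCocycles (subgroupRep (tateRep W 3).toTopRep (cycSubgroup 3 0 r)))
                    (ψT : contOneCocycles ((tateLocalRep W 3 (Sum.inr ((Rat.HeightOneSpectrum.primesEquiv (R := 𝓞 ℚ)).symm ⟨3, Fact.out⟩))).restrict
                      (absGaloisRestrict (((Rat.HeightOneSpectrum.primesEquiv (R := 𝓞 ℚ)).symm ⟨3, Fact.out⟩).adicCompletion ℚ) (w₀.1.adicCompletion (CyclotomicField (cycLevel 3 0 r) ℚ)))).toTopRep),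
                    oneCocycleClass _ φ'' = conjMap (tateRep W 3).toTopRep (cycSubgroup 3 0 r) (g w) 1 y →
                    (∀ σ, ψT.1 σ = φ''.1 ⟨absGaloisRestrictTower ℚ (((Rat.HeightOneSpectrum.primesEquiv (R := 𝓞 ℚ)).symm ⟨3, Fact.out⟩).adicCompletion ℚ) (w₀.1.adicCompletion (CyclotomicField (cycLevel 3 0 r) ℚ)) σ,
                      absGaloisRestrictTower_adicCompletion_mem_cycSubgroup r w₀ σ⟩) →
                    Ψ (Λ 0 r y) w = galAdicCompletionMap
                      (sigma (cycLevel 3 0 r) (modNCyclotomicCharacter ℚ (cycLevel 3 0 r) (g w)))⁻¹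
                      (inv_smul_eq_of_smul_eq (hg w))
                      ((expStarOmegaHom (LocalField.valuation_adicCompletion_natCast_lt_one w₀.1 3 (three_mem_asIdeal_extension _ w₀))
                      ((galRestrictPlace ((Rat.HeightOneSpectrum.primesEquiv (R := 𝓞 ℚ)).symm ⟨3, Fact.out⟩)).comp
                      (absGaloisRestrict (((Rat.HeightOneSpectrum.primesEquiv (R := 𝓞 ℚ)).symm ⟨3, Fact.out⟩).adicCompletion ℚ) (w₀.1.adicCompletion (CyclotomicField (cycLevel 3 0 r) ℚ)))) dw hinjw hexw) (oneCocycleClass _ ψT)))) ∧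
            ∀ (c d a : ℤ) (A : ℕ), 0 < A → Int.gcd c (6 * 3 * A) = 1 → Int.gcd d (6 * 3 * N) = 1 →
              ∃ (z : ∀ (k' : ℕ) (r : (cyclotomicLevelsRat 3 (badPlaces c d A N)).Ideals),
                    H1 (tateRep W 3) ((cyclotomicLevelsRat 3 (badPlaces c d A N)).level k' r.1))
                (x : ∀ (k' : ℕ) (r : (cyclotomicLevelsRat 3 (badPlaces c d A N)).Ideals),
                    CyclotomicField (cycLevel 3 k' r.1) ℚ),
                ZetaBody W 3 P.f ι κK Λ c d a A z x)

include hKatoV2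

/-! ### §1 Item 20397 `FineKatoTauAnomalousThree` BY NAME ⟸ (S5a) ∧ (S5b-tower) ∧ hKatoV2ʷ -/

set_option backward.isDefEq.respectTransparency false in
/-- **Item 20397 `FineKatoTauAnomalousThree` BY NAME ⟸ (S5a) ∧ (S5b-tower) ∧ hKatoV2ʷ.**  At a good-anomalous `t = 0` tower row
(`3 ∤ N = conductor`, so good reduction at `3`; `3 ∣ 3 + 1 − t₃`): (C1ₑₓ^τ) from `definedKatoTwist_of_katoV2_of_facts`, then gen 10's
`fineKatoτ_of_definedKatoTwist` ((C1ₑₓ^τ) ⟹ (C1_τ), the twist operator being injective — no digit lost).  CONDITIONAL on the two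
cite facts and the displayed Kato-side statement; nothing booked.
[cite: Kato2004Asterisque, (8.1.3) (p. 180), §9.4 (p. 188), Thm. 9.7 (p. 189) and Ex. 13.3 (pp. 224–225)]
[cite: BlochKato1990, §3 Prop. 3.8, Ex. 3.11] [cite: Kim2022StructureSelmer, Lemma 3.4, Cor. 3.5, Thm. 3.13]
[cite: CasselsFrohlichANT1967, Ch. II §10 Theorem (10.2) and §11, Ch. VII §1.1] -/
theorem fineKatoTauAnomalousThree_of_katoV2_of_facts (hS : expStarCoord_eq_zero_iff_kummer)
    (hT₂ : exists_smul_range_expStarCoord_tower_iff_trace_log) : FineKatoTauAnomalousThree := by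
  intro W₀ _ _ htow ht N _ hN D₀ hlat _ hN3 v₃ hv₃ t₃ ht₃ h3a
  have hgood : W₀.HasGoodReductionAtPrime 3 :=
    hasGoodReductionAtPrime_three_of_not_dvd_conductorNorm W₀ (by rw [← hN]; exact hN3)
  -- explicit mode: the instance binders of (C1_τ) / (C1ₑₓ^τ) stay bound (they are the item's inner `∀ […]`)
  exact @fineKatoτ_of_definedKatoTwist W₀ _ _ N _ D₀ hgood v₃ ht t₃ ht₃
    (@definedKatoTwist_of_katoV2_of_facts hS hT₂ hKatoV2 W₀ _ _ htow hgood ht v₃ hv₃ N _ D₀ hN hlat t₃ ht₃ h3a)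

/-! ### §2 `stub_nonAdditive` of crux 19599 ⟸ leaves ∧ (S5a) ∧ (S5b-tower) ∧ hKatoV2ʷ -/

/-- **`stub_nonAdditive` of crux 19599 (BC3 birth text, VERBATIM) from [S24](1)(2) ∧ GZK ∧ PT ∧ (S5a) ∧ (S5b-tower) ∧ hKatoV2ʷ** —
EVERY non-additive `t = 0` tower row (good ordinary / supersingular / anomalous, multiplicative): the dispatch of
`KimAtThreeShallowEqDeepWeightedItems.stub19599_nonAdditive_of_weightedRouteItems` with item 20275 BY NAME
(`definedKatoWeightedNonAdditiveThree_of_katoV2_of_facts`) and item 20397 BY NAME (§1).  CONDITIONAL; nothing booked.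
[cite: Kim2025RefinedTNC, Thm 1.2] [cite: Kim2022StructureSelmer, Thm. 1.9 (6), §3.2.3, Thm. 3.13] [cite: Sakamoto2024, Thm. 4.4 (p. 926)]
[cite: MazurRubin2004, Thm. 5.2.12] [cite: Kato2004Asterisque, §9.4 (p. 188), Thm. 9.7 (p. 189)] -/
theorem stub19599_nonAdditive_of_katoV2_of_facts
    (hS24 : Sakamoto2024.kolyvaginSystems_freeRankOne_zmod_three_pow)
    (hS24₂ : Sakamoto2024.kolyvaginSystems_idealOfBasis_eq_fittingIdeal_zmod_three_pow)
    (hGZK : rank_eq_analyticRank_of_analyticRank_le_one) (hPT : poitouTate_selmerStructure_duality ℚ)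
    (hS : expStarCoord_eq_zero_iff_kummer) (hT₂ : exists_smul_range_expStarCoord_tower_iff_trace_log) :
    STUB19599NA :=
  stub19599_nonAdditive_of_weightedRouteItems hS24 hS24₂ hGZK hPT
    (by
      intro W₀ _ _ htow _ N _ hN D₀ hlat _ _ v₃ hv₃ _ _ _
      exact definedKatoWeighted_of_katoV2_of_facts hS hT₂ hKatoV2 W₀ htow v₃ hv₃ D₀ hN hlat)
    (fineKatoTauAnomalousThree_of_katoV2_of_facts hKatoV2 hS hT₂)

/-! ### §3 Cruxes 19599 / 19077 BY NAME ⟸ leaves ∧ (S5a) ∧ (S5b-tower) ∧ hKatoV2ʷ ∧ item 20398 -/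

/-- **Crux 19599 `ShallowEqDeepOffKatoStratum` BY NAME ⟸ `SakamotoKolyvaginThree ∧ RankEqAnalyticRankLeOne ∧ PoitouTateSelmerDuality`
(route leaves) ∧ (S5a) ∧ (S5b-tower) ∧ hKatoV2ʷ ∧ item 20398 `FineKatoTwoExpDefectThree` (additive-defect rows).**  The non-additive
rows are §2 / §1; the additive-defect rows stay on acc3's registered package.  CONDITIONAL; nothing booked; 19599 stays OPEN.
[cite: Kim2025RefinedTNC, Thm 1.1, Thm 1.2] [cite: Kim2022StructureSelmer, Thm. 1.9 (6), Thm. 3.13] [cite: Sakamoto2024, Thm. 4.4 (p. 926)]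
[cite: MazurRubin2004, Thm. 4.4.1 and Thm. 5.2.12] [cite: Kato2004Asterisque, §9.4 (p. 188), Thm. 9.7 (p. 189), Ex. 13.3] -/
theorem shallowEqDeepOffKatoStratum_of_katoV2_of_facts
    (hSak : SakamotoKolyvaginThree) (hGZK : RankEqAnalyticRankLeOne) (hPT : PoitouTateSelmerDuality)
    (hS : expStarCoord_eq_zero_iff_kummer) (hT₂ : exists_smul_range_expStarCoord_tower_iff_trace_log)
    (h₃ : FineKatoTwoExpDefectThree) :
    ShallowEqDeepOffKatoStratum :=
  shallowEqDeepOffKatoStratum_of_weightedRouteItems hSak hGZK hPT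
    (by
      intro W₀ _ _ htow _ N _ hN D₀ hlat _ _ v₃ hv₃ _ _ _
      exact definedKatoWeighted_of_katoV2_of_facts hS hT₂ hKatoV2 W₀ htow v₃ hv₃ D₀ hN hlat)
    (fineKatoTauAnomalousThree_of_katoV2_of_facts hKatoV2 hS hT₂) h₃

/-- **Crux 19077 `ShallowEqDeepAtTorsionFree` BY NAME ⟸ the four route leaves ∧ crux 19560 `KatoKuriharaPortThreeShared` ∧ (S5a) ∧
(S5b-tower) ∧ hKatoV2ʷ ∧ item 20398** (gen 4's stub-free glue on the 19599 form above; no `StubAtEmptyLevelThree`).  CONDITIONAL;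
nothing booked; 19077 stays OPEN. [cite: Kim2025RefinedTNC, Thm 1.2] [cite: Sakamoto2024, Thm. 4.4 (p. 926)]
[cite: MazurRubin2004, Thm. 4.4.1 and Thm. 5.2.12] [cite: Kato2004Asterisque, Thm. 9.7 (p. 189), Ex. 13.3] [cite: Carayol1986] -/
theorem shallowEqDeepAtTorsionFree_of_katoV2_of_facts
    (hSak : SakamotoKolyvaginThree) (hGZK : RankEqAnalyticRankLeOne) (hPT : PoitouTateSelmerDuality)
    (hlev : CarayolLevelEqConductor) (hPort : KatoKuriharaPortThreeShared)
    (hS : expStarCoord_eq_zero_iff_kummer) (hT₂ : exists_smul_range_expStarCoord_tower_iff_trace_log)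
    (h₃ : FineKatoTwoExpDefectThree) :
    ShallowEqDeepAtTorsionFree :=
  shallowEqDeepAtTorsionFree_of_weightedRouteItems hSak hGZK hPT hlev hPort
    (by
      intro W₀ _ _ htow _ N _ hN D₀ hlat _ _ v₃ hv₃ _ _ _
      exact definedKatoWeighted_of_katoV2_of_facts hS hT₂ hKatoV2 W₀ htow v₃ hv₃ D₀ hN hlat)
    (fineKatoTauAnomalousThree_of_katoV2_of_facts hKatoV2 hS hT₂) h₃

end OfKatoV2

end Summit.BirchSwinnertonDyer.BirchSwinnertonDyer.Theorems.KimAtThreeShallowEqDeepNonAdditiveOfKatoV2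

end
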